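import Mathlib
import Summits.Ventures.PercRepro.TriangleCapCherryDiamond

/-!
# PercRepro — THE `K₄⁻`-FREE CHERRY ENVELOPE IS THE TRIANGLE-FREE ENVELOPE FOR `k ≥ 6`: `Σ_v d(v)² ≤ m·k`,
every triangle costing `k − 6`; the dense corner's diagonal `(k, a(k−a))` is exact (p3, gen 34; part 28)

TriangleCapCherryMantel gives `Σ_v d(v)² ≤ m·k` on triangle-free graphs (Mantel's degree-sum lemma) and
TriangleCapCherryDiamond `Σ_v d(v)² ≤ m (k + 1)` on `K₄⁻`-free graphs.  This module closes the gap between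
the two envelopes for `k ≥ 6`: the triangles of a `K₄⁻`-free graph do not help.

On an ordered adjacent pair `(u, v)` write `codeg (u, v) = |N(u) ∩ N(v)|` (`≤ 1`, `card_inter_le_one_of_adj`) and
`deficit (u, v) = |V ∖ (N(u) ∪ N(v))|`; then `d(u) + d(v) + deficit (u, v) = k + codeg (u, v)` on EVERY pair
(`deg_add_deg_add_deficit`).  Summed over the `2m` ordered adjacent pairs (`adjPairsAll`):
`2 Σ_v d(v)² + Σ deficit = 2mk + |T₃|`, where `T₃` is the set of ordered triangles `((u, v), w)`
(`sum_codeg_adjPairsAll`).  The deficits pay for the triangles: a vertex `x` outside a triangle `u v w` is adjacent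
to at most ONE of `u, v, w` (two would be two common neighbours of an edge), so it lies in one of the three sets
`V ∖ (N(u) ∪ N(v))`, `V ∖ (N(v) ∪ N(w))`, `V ∖ (N(w) ∪ N(u))`, and the three deficits of a triangle sum to at least
`k − 3` (`deficit_triangle`).  The rotation `((u, v), w) ↦ ((v, w), u)` is a bijection of `T₃`
(`sum_triangles3_rot`), so `3 Σ_{T₃} deficit (u, v) ≥ (k − 3) |T₃|`, and `Σ_{T₃} deficit (u, v) ≤ Σ deficit` because
`codeg ≤ 1` (`sum_triangles3_fst`).  Hence, for every `K₄⁻`-free graph on `k` vertices with `m` edges,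

* `six_mul_sum_deg_sq_add_le` — `6 Σ_v d(v)² + (k − 3) |T₃| ≤ 6mk + 3 |T₃|` (no hypothesis on `k`);
* `six_mul_sum_deg_sq_add_triangles_le` — `6 Σ_v d(v)² + (k − 6) |T₃| ≤ 6mk` for `k ≥ 6`: every ordered triangle costs
  `(k − 6)/6`, every triangle `k − 6`;
* **`sum_deg_sq_le_of_k4mFree`** — `Σ_v d(v)² ≤ m·k` for `k ≥ 6`;
* **`dense_cherries`** — `2·Σ_v C(d(v), 2) + 2m ≤ m·k`, i.e. `Σ_v C(d(v), 2) ≤ m(k−2)/2`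
  (`cherries_le_of_k4mFree_six`), for every `K₄⁻`-free graph on `k ≥ 6` vertices — the Mantel envelope;
* `cliqueFree_of_dense_eq` — for `k ≥ 7`, equality forces the graph to be triangle-free;
* **`diagonal_cells_exact`** — for `k ≥ 6` and every `a ≤ k` the `K₄⁻`-free cherry maximum at `(k, a(k−a))` IS
  `a(k−a)(k−2)/2`, attained by `K_{a, k−a}` (`mantel_eq_bip`): the dense corner's diagonal — `(6,9) 18`,
  `(7,12) 30`, `(8,15) 45`, `(8,16) 48`, `(9,18) 63`, `(9,20) 70`, `(10,21) 84`, `(10,24) 96`, `(10,25) 100`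
  (`dense_diagonal_values`), beside the sparse cells `(k, k−1)` (the star) and `(k, 2(k−2))` (`K_{2,k−2}`).

The bound is false at `k ≤ 5` (the bowtie: `32 > 30` at `(5, 6)`), where `6 − k` triangles' worth is gained
instead: `Σ_v d(v)² ≤ m·k + (6 − k)·#triangles`, which is what `six_mul_sum_deg_sq_add_le` reads there.
Numbers first (mining/p3/g34/envelope_check.py): every `K₄⁻`-free labelled graph on `k = 6` (14,009) and `k = 7`
(459,561) vertices satisfies `Σ d² + (k − 6)·#triangles ≤ m·k`, with `242` resp. `64` equality cases; the planted
claims `Σ d² + 1 ≤ m·k` and `Σ d² + (k − 5)·#triangles ≤ m·k` fail (`K_{a,b}`; the prism at `k = 6`).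
Axioms: standard.
-/

namespace PercRepro

namespace TriangleCap

namespace C047

open Finset

variable {V : Type*} [Fintype V] [DecidableEq V]

omit [DecidableEq V] in
/-- The deficit of the ordered pair `(u, v)`: the number of vertices adjacent to neither `u` nor `v`. -/
def deficit (D : SimpleGraph V) [DecidableRel D.Adj] (p : V × V) : ℕ :=
  (univ.filter (fun x => ¬ D.Adj p.1 x ∧ ¬ D.Adj p.2 x)).card

omit [DecidableEq V] in
/-- The common neighbours of the ordered pair `(u, v)`. -/
def codeg (D : SimpleGraph V) [DecidableRel D.Adj] (p : V × V) : ℕ :=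
  (univ.filter (fun x => D.Adj p.1 x ∧ D.Adj p.2 x)).card

omit [DecidableEq V] in
/-- The ordered triangles `((u, v), w)` with `u ~ v`, `u ~ w`, `v ~ w` (each triangle six times). -/
def triangles3 (D : SimpleGraph V) [DecidableRel D.Adj] : Finset ((V × V) × V) :=
  (adjPairsAll D ×ˢ univ).filter (fun t => D.Adj t.1.1 t.2 ∧ D.Adj t.1.2 t.2)

omit [DecidableEq V] in
/-- Membership in `adjPairsAll`. -/
theorem mem_adjPairsAll (D : SimpleGraph V) [DecidableRel D.Adj] (p : V × V) :
    p ∈ adjPairsAll D ↔ D.Adj p.1 p.2 := by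
  simp only [adjPairsAll, mem_filter, mem_product, mem_univ, true_and]

omit [DecidableEq V] in
/-- Membership in `triangles3`. -/
theorem mem_triangles3 (D : SimpleGraph V) [DecidableRel D.Adj] (t : (V × V) × V) :
    t ∈ triangles3 D ↔ D.Adj t.1.1 t.1.2 ∧ D.Adj t.1.1 t.2 ∧ D.Adj t.1.2 t.2 := by
  simp only [triangles3, mem_filter, mem_product, mem_univ, and_true, mem_adjPairsAll]

/-- The pointwise identity `d(u) + d(v) + deficit (u, v) = k + codeg (u, v)` on every ordered pair. -/
theorem deg_add_deg_add_deficit (D : SimpleGraph V) [DecidableRel D.Adj] (p : V × V) :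
    deg D p.1 + deg D p.2 + deficit D p = Fintype.card V + codeg D p := by
  set A := univ.filter (fun x => D.Adj p.1 x) with hA
  set B := univ.filter (fun x => D.Adj p.2 x) with hB
  have hdegA : deg D p.1 = A.card := rfl
  have hdegB : deg D p.2 = B.card := rfl
  have hcod : codeg D p = (A ∩ B).card := by
    unfold codeg
    rw [hA, hB, ← filter_and]
  have hdef : deficit D p = (A ∪ B)ᶜ.card := by
    unfold deficit
    congr 1
    ext x
    simp only [mem_filter, mem_univ, true_and, mem_compl, mem_union, hA, hB, not_or]
  have h1 := card_union_add_card_inter A B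
  have h2 := card_compl (A ∪ B)
  have h3 := card_le_univ (A ∪ B)
  omega

/-- `codeg ≤ 1` on every ordered adjacent pair of a `K₄⁻`-free graph. -/
theorem codeg_le_one (D : SimpleGraph V) [DecidableRel D.Adj] (hK : K4mFree D) {p : V × V}
    (hp : p ∈ adjPairsAll D) : codeg D p ≤ 1 := by
  have h := card_inter_le_one_of_adj D hK ((mem_adjPairsAll D p).mp hp)
  unfold codeg
  rw [← filter_and] at h
  exact h

omit [DecidableEq V] in
/-- A sum over the ordered triangles of a function of the pair is the `codeg`-weighted sum over the pairs. -/
theorem sum_triangles3_fst (D : SimpleGraph V) [DecidableRel D.Adj] (f : V × V → ℕ) :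
    ∑ t ∈ triangles3 D, f t.1 = ∑ p ∈ adjPairsAll D, codeg D p * f p := by
  unfold triangles3
  rw [sum_filter, sum_product]
  apply sum_congr rfl
  intro p _
  dsimp only
  rw [← sum_filter, sum_const, smul_eq_mul]
  rfl

omit [DecidableEq V] in
/-- `Σ_{(u,v)} codeg (u, v) = |T₃|`. -/
theorem sum_codeg_adjPairsAll (D : SimpleGraph V) [DecidableRel D.Adj] :
    ∑ p ∈ adjPairsAll D, codeg D p = (triangles3 D).card := by
  rw [card_eq_sum_ones, sum_triangles3_fst D (fun _ => 1)]
  simp only [mul_one]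

omit [DecidableEq V] in
/-- The rotation `((u, v), w) ↦ ((v, w), u)` preserves the ordered triangles. -/
theorem sum_triangles3_rot (D : SimpleGraph V) [DecidableRel D.Adj] (f : V × V → ℕ) :
    ∑ t ∈ triangles3 D, f (t.1.2, t.2) = ∑ t ∈ triangles3 D, f t.1 := by
  apply sum_nbij' (fun t => ((t.1.2, t.2), t.1.1)) (fun t => ((t.2, t.1.1), t.1.2))
  · intro t ht
    rw [mem_triangles3] at ht ⊢
    exact ⟨ht.2.2, ht.1.symm, ht.2.1.symm⟩
  · intro t ht
    rw [mem_triangles3] at ht ⊢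
    exact ⟨ht.2.1.symm, ht.2.2.symm, ht.1⟩
  · intro t _
    rfl
  · intro t _
    rfl
  · intro t _
    rfl

omit [DecidableEq V] in
/-- The rotation applied twice: `((u, v), w) ↦ ((w, u), v)`. -/
theorem sum_triangles3_rot2 (D : SimpleGraph V) [DecidableRel D.Adj] (f : V × V → ℕ) :
    ∑ t ∈ triangles3 D, f (t.2, t.1.1) = ∑ t ∈ triangles3 D, f t.1 := by
  apply sum_nbij' (fun t => ((t.2, t.1.1), t.1.2)) (fun t => ((t.1.2, t.2), t.1.1))
  · intro t ht
    rw [mem_triangles3] at ht ⊢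
    exact ⟨ht.2.1.symm, ht.2.2.symm, ht.1⟩
  · intro t ht
    rw [mem_triangles3] at ht ⊢
    exact ⟨ht.2.2, ht.1.symm, ht.2.1.symm⟩
  · intro t _
    rfl
  · intro t _
    rfl
  · intro t _
    rfl

/-- Two common neighbours `w ≠ x` of the edge `u v` contradict `K₄⁻`-freeness. -/
theorem not_adj_both (D : SimpleGraph V) [DecidableRel D.Adj] (hK : K4mFree D) {u v w x : V}
    (huv : D.Adj u v) (huw : D.Adj u w) (hvw : D.Adj v w) (hwx : w ≠ x) (hux : D.Adj u x)
    (hvx : D.Adj v x) : False := by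
  have h := card_inter_le_one_of_adj D hK huv
  have h2 : 1 < ((univ.filter (fun y => D.Adj u y)) ∩ (univ.filter (fun y => D.Adj v y))).card := by
    rw [one_lt_card]
    refine ⟨w, ?_, x, ?_, hwx⟩
    · rw [mem_inter, mem_filter, mem_filter]
      exact ⟨⟨mem_univ _, huw⟩, ⟨mem_univ _, hvw⟩⟩
    · rw [mem_inter, mem_filter, mem_filter]
      exact ⟨⟨mem_univ _, hux⟩, ⟨mem_univ _, hvx⟩⟩
  omega

/-- **The three deficits of a triangle sum to at least `k − 3`:** a vertex outside the triangle `u v w` of a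
`K₄⁻`-free graph is adjacent to at most one of `u, v, w`, hence lies in one of the three deficit sets. -/
theorem deficit_triangle (D : SimpleGraph V) [DecidableRel D.Adj] (hK : K4mFree D) {u v w : V}
    (huv : D.Adj u v) (huw : D.Adj u w) (hvw : D.Adj v w) :
    Fintype.card V ≤ deficit D (u, v) + deficit D (v, w) + deficit D (w, u) + 3 := by
  set S₁ := univ.filter (fun x => ¬ D.Adj u x ∧ ¬ D.Adj v x) with hS₁
  set S₂ := univ.filter (fun x => ¬ D.Adj v x ∧ ¬ D.Adj w x) with hS₂
  set S₃ := univ.filter (fun x => ¬ D.Adj w x ∧ ¬ D.Adj u x) with hS₃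
  have e1 : deficit D (u, v) = S₁.card := rfl
  have e2 : deficit D (v, w) = S₂.card := rfl
  have e3 : deficit D (w, u) = S₃.card := rfl
  have hsub : ({u, v, w} : Finset V)ᶜ ⊆ S₁ ∪ S₂ ∪ S₃ := by
    intro x hx
    rw [mem_compl] at hx
    simp only [mem_insert, mem_singleton, not_or] at hx
    obtain ⟨hxu, hxv, hxw⟩ := hx
    rw [mem_union, mem_union, hS₁, hS₂, hS₃, mem_filter, mem_filter, mem_filter]
    simp only [mem_univ, true_and]
    by_cases hux : D.Adj u x <;> by_cases hvx : D.Adj v x <;> by_cases hwx : D.Adj w x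
    · exact (not_adj_both D hK huv huw hvw (Ne.symm hxw) hux hvx).elim
    · exact (not_adj_both D hK huv huw hvw (Ne.symm hxw) hux hvx).elim
    · exact (not_adj_both D hK huw huv hvw.symm (Ne.symm hxv) hux hwx).elim
    · exact Or.inl (Or.inr ⟨hvx, hwx⟩)
    · exact (not_adj_both D hK hvw huv.symm huw.symm (Ne.symm hxu) hvx hwx).elim
    · exact Or.inr ⟨hwx, hux⟩
    · exact Or.inl (Or.inl ⟨hux, hvx⟩)
    · exact Or.inl (Or.inl ⟨hux, hvx⟩)
  have hcard3 : ({u, v, w} : Finset V).card = 3 := by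
    rw [card_insert_of_notMem, card_pair hvw.ne]
    simp only [mem_insert, mem_singleton, not_or]
    exact ⟨huv.ne, huw.ne⟩
  have h1 := card_le_card hsub
  have h2 := card_union_le (S₁ ∪ S₂) S₃
  have h3 := card_union_le S₁ S₂
  have h4 := card_compl ({u, v, w} : Finset V)
  rw [hcard3] at h4
  omega

/-- The ordered adjacent pairs, summed with their deficits: `2 Σ_v d(v)² + Σ deficit = 2mk + |T₃|`. -/
theorem two_mul_sum_deg_sq_add_sum_deficit (D : SimpleGraph V) [DecidableRel D.Adj] :
    2 * ∑ v, deg D v * deg D v + ∑ p ∈ adjPairsAll D, deficit D p =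
      2 * D.edgeFinset.card * Fintype.card V + (triangles3 D).card := by
  have h1 : ∑ p ∈ adjPairsAll D, (deg D p.1 + deg D p.2) = 2 * ∑ v, deg D v * deg D v := by
    rw [sum_add_distrib, sum_snd_adjPairsAll, sum_fst_adjPairsAll]
    ring
  have h2 : ∑ p ∈ adjPairsAll D, (deg D p.1 + deg D p.2 + deficit D p) =
      ∑ p ∈ adjPairsAll D, (Fintype.card V + codeg D p) :=
    sum_congr rfl (fun p _ => deg_add_deg_add_deficit D p)
  rw [sum_add_distrib, h1, sum_add_distrib, sum_const, smul_eq_mul, card_adjPairsAll,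
    sum_codeg_adjPairsAll] at h2
  linarith [h2]

/-- **THE GENERAL FORM:** `6 Σ_v d(v)² + (k − 3) |T₃| ≤ 6mk + 3 |T₃|` for every `K₄⁻`-free graph. -/
theorem six_mul_sum_deg_sq_add_le (D : SimpleGraph V) [DecidableRel D.Adj] (hK : K4mFree D) :
    6 * ∑ v, deg D v * deg D v + (Fintype.card V - 3) * (triangles3 D).card ≤
      6 * (D.edgeFinset.card * Fintype.card V) + 3 * (triangles3 D).card := by
  have hsum := two_mul_sum_deg_sq_add_sum_deficit D
  -- the triangle deficits are at most the pair deficits (`codeg ≤ 1`)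
  have hle : ∑ t ∈ triangles3 D, deficit D t.1 ≤ ∑ p ∈ adjPairsAll D, deficit D p := by
    rw [sum_triangles3_fst]
    apply sum_le_sum
    intro p hp
    calc codeg D p * deficit D p ≤ 1 * deficit D p := Nat.mul_le_mul_right _ (codeg_le_one D hK hp)
      _ = deficit D p := one_mul _
  -- three times the triangle deficits, by the rotation
  have hrot : 3 * ∑ t ∈ triangles3 D, deficit D t.1 =
      ∑ t ∈ triangles3 D, (deficit D t.1 + deficit D (t.1.2, t.2) + deficit D (t.2, t.1.1)) := by
    rw [sum_add_distrib, sum_add_distrib, sum_triangles3_rot, sum_triangles3_rot2]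
    ring
  have hpt : ∑ t ∈ triangles3 D, (Fintype.card V - 3) ≤
      ∑ t ∈ triangles3 D, (deficit D t.1 + deficit D (t.1.2, t.2) + deficit D (t.2, t.1.1)) := by
    apply sum_le_sum
    intro t ht
    rw [mem_triangles3] at ht
    have h := deficit_triangle D hK ht.1 ht.2.1 ht.2.2
    have e : deficit D t.1 = deficit D (t.1.1, t.1.2) := rfl
    omega
  rw [sum_const, smul_eq_mul, ← hrot] at hpt
  linarith [hsum, hle, hpt]

/-- **EVERY TRIANGLE COSTS `k − 6`:** `6 Σ_v d(v)² + (k − 6) |T₃| ≤ 6mk` for `k ≥ 6`. -/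
theorem six_mul_sum_deg_sq_add_triangles_le (D : SimpleGraph V) [DecidableRel D.Adj] (hK : K4mFree D)
    (hk : 6 ≤ Fintype.card V) :
    6 * ∑ v, deg D v * deg D v + (Fintype.card V - 6) * (triangles3 D).card ≤
      6 * (D.edgeFinset.card * Fintype.card V) := by
  have h := six_mul_sum_deg_sq_add_le D hK
  obtain ⟨j, hj⟩ := Nat.exists_eq_add_of_le hk
  rw [hj] at h ⊢
  have e1 : 6 + j - 3 = j + 3 := by omega
  have e2 : 6 + j - 6 = j := by omega
  rw [e1, add_mul] at h
  rw [e2]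
  linarith [h]

/-- **THE MANTEL ENVELOPE HOLDS ON `K₄⁻`-FREE GRAPHS FOR `k ≥ 6`:** `Σ_v d(v)² ≤ m·k`. -/
theorem sum_deg_sq_le_of_k4mFree (D : SimpleGraph V) [DecidableRel D.Adj] (hK : K4mFree D)
    (hk : 6 ≤ Fintype.card V) :
    ∑ v, deg D v * deg D v ≤ D.edgeFinset.card * Fintype.card V := by
  have h := six_mul_sum_deg_sq_add_triangles_le D hK hk
  omega

/-- **THE CHERRY ENVELOPE ON `K₄⁻`-FREE GRAPHS WITH `k ≥ 6` VERTICES:** `2·Σ_v C(d(v), 2) + 2m ≤ m·k`. -/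
theorem dense_cherries (D : SimpleGraph V) [DecidableRel D.Adj] (hK : K4mFree D)
    (hk : 6 ≤ Fintype.card V) :
    2 * cherries D + 2 * D.edgeFinset.card ≤ D.edgeFinset.card * Fintype.card V := by
  have h := sum_deg_sq_le_of_k4mFree D hK hk
  rw [← two_mul_cherries_add, sum_deg_eq] at h
  exact h

/-- `Σ_v C(d(v), 2) ≤ m(k−2)/2` for a `K₄⁻`-free graph on `k ≥ 6` vertices with `m` edges. -/
theorem cherries_le_of_k4mFree_six (D : SimpleGraph V) [DecidableRel D.Adj] (hK : K4mFree D)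
    (hk : 6 ≤ Fintype.card V) :
    cherries D ≤ D.edgeFinset.card * (Fintype.card V - 2) / 2 := by
  have h := dense_cherries D hK hk
  obtain ⟨k, hk'⟩ := Nat.exists_eq_add_of_le hk
  rw [hk'] at h ⊢
  rw [Nat.le_div_iff_mul_le (by norm_num)]
  have e : 6 + k - 2 = k + 4 := by omega
  rw [e]
  linarith [h]

/-- **EQUALITY FORCES TRIANGLE-FREENESS FOR `k ≥ 7`:** if `2·cherries + 2m = m·k` then there is no triangle. -/
theorem cliqueFree_of_dense_eq (D : SimpleGraph V) [DecidableRel D.Adj] (hK : K4mFree D)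
    (hk : 7 ≤ Fintype.card V)
    (heq : 2 * cherries D + 2 * D.edgeFinset.card = D.edgeFinset.card * Fintype.card V) :
    D.CliqueFree 3 := by
  have h := six_mul_sum_deg_sq_add_triangles_le D hK (by omega)
  rw [← two_mul_cherries_add, sum_deg_eq] at h
  have hT : (triangles3 D).card = 0 := by
    obtain ⟨j, hj⟩ := Nat.exists_eq_add_of_le hk
    rw [hj] at h heq
    have e : 7 + j - 6 = j + 1 := by omega
    rw [e] at h
    have h0 : (j + 1) * (triangles3 D).card ≤ 0 := by
      have e' : 6 * (2 * cherries D + 2 * D.edgeFinset.card) =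
          6 * (D.edgeFinset.card * (7 + j)) := by rw [heq]
      linarith [h, e']
    rcases mul_eq_zero.mp (Nat.eq_zero_of_le_zero h0) with h' | h'
    · omega
    · exact h'
  intro S hS
  rw [SimpleGraph.is3Clique_iff] at hS
  obtain ⟨a, b, c, hab, hac, hbc, -⟩ := hS
  have hmem : ((a, b), c) ∈ triangles3 D := (mem_triangles3 D _).mpr ⟨hab, hac, hbc⟩
  have := card_pos.mpr ⟨_, hmem⟩
  omega

/-- **THE DENSE CORNER'S DIAGONAL IS EXACT:** for `k ≥ 6` and every `a ≤ k`, the maximum of `Σ_v C(d(v), 2)`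
over `K₄⁻`-free graphs with `a(k−a)` edges on `k` vertices is `a(k−a)(k−2)/2`, attained by `K_{a, k−a}`. -/
theorem diagonal_cells_exact (k a : ℕ) (hk : 6 ≤ k) (ha : a ≤ k) :
    (∀ (D : SimpleGraph (Fin k)) [DecidableRel D.Adj], K4mFree D → D.edgeFinset.card = a * (k - a) →
        2 * cherries D ≤ a * (k - a) * (k - 2)) ∧
      ∃ (D : SimpleGraph (Fin k)) (_ : DecidableRel D.Adj),
        K4mFree D ∧ D.edgeFinset.card = a * (k - a) ∧ 2 * cherries D = a * (k - a) * (k - 2) := by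
  refine ⟨fun D _ hK hm => ?_, bip k a, inferInstance, k4mFree_bip k a, card_edges_bip k a ha, ?_⟩
  · have h := dense_cherries D hK (by rw [Fintype.card_fin]; exact hk)
    rw [Fintype.card_fin, hm] at h
    have e2 : k - 2 + 2 = k := by omega
    have : a * (k - a) * (k - 2) + 2 * (a * (k - a)) = a * (k - a) * k := by
      calc a * (k - a) * (k - 2) + 2 * (a * (k - a)) = a * (k - a) * (k - 2 + 2) := by ring
        _ = a * (k - a) * k := by rw [e2]
    omega
  · have h := mantel_eq_bip k a ha
    rw [card_edges_bip k a ha] at h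
    have e2 : k - 2 + 2 = k := by omega
    have : a * (k - a) * (k - 2) + 2 * (a * (k - a)) = a * (k - a) * k := by
      calc a * (k - a) * (k - 2) + 2 * (a * (k - a)) = a * (k - a) * (k - 2 + 2) := by ring
        _ = a * (k - a) * k := by rw [e2]
    omega

/-- The nine dense diagonal cells of the `k ≤ 10` census read off the formula `a(k−a)(k−2)/2`:
`(6,9) 18 · (7,12) 30 · (8,15) 45 · (8,16) 48 · (9,18) 63 · (9,20) 70 · (10,21) 84 · (10,24) 96 · (10,25) 100`. -/
theorem dense_diagonal_values :
    3 * (6 - 3) * (6 - 2) / 2 = 18 ∧ 3 * (7 - 3) * (7 - 2) / 2 = 30 ∧ 3 * (8 - 3) * (8 - 2) / 2 = 45 ∧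
      4 * (8 - 4) * (8 - 2) / 2 = 48 ∧ 3 * (9 - 3) * (9 - 2) / 2 = 63 ∧ 4 * (9 - 4) * (9 - 2) / 2 = 70 ∧
      3 * (10 - 3) * (10 - 2) / 2 = 84 ∧ 4 * (10 - 4) * (10 - 2) / 2 = 96 ∧
      5 * (10 - 5) * (10 - 2) / 2 = 100 := by
  decide

end C047

end TriangleCap

end PercRepro
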